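import Mathlib
import HarnessLib
import Literature.MathematicalPhysics.StatisticalMechanics.SecondDifferencePredicateBilinear
import Literature.MathematicalPhysics.StatisticalMechanics.RenormalisationMapFreeHtSmooth
import Summits.HubbardSuperconductivity.HubbardSuperconductivity.Theorems.ComplexGFFStiffnessF4l2BlockB4Line

/-!
# Crux child `TwoKernelSkBound` (stmt-HubbardSuperconductivity-27414), line `banach_two_kernel`: the registered stub
# `stub_blockB4` — the KERNEL PARALLELOGRAM of `K_{k+1}` at the fixed intermediate Hamiltonian `H̃_q`, `N`-free

Route `route-HubbardSuperconductivity-ComplexGFFStiffness`, cruxes stmt-…-19154 `HypACumulant` / stmt-…-19155 `HypALocalTwoPoint`;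
skeleton v3 `Cruxes/HypACumulant/Lines/banach_two_kernel.lean` (memo `Cruxes/HypACumulant/TWOKERNEL-PLAN-27414-v3.md` §2 (R4)).
Block B4 of the four-corner split of the second `q`-difference of `S_k` is the kernel parallelogram
`G_{q+y+z} − G_{q+y} − G_{q+z} + G_q`, `G_ρ = nextK(μ_ρ; e^{−toHam u}, e^{−H̃_q}, mulExt v)`, at the fixed `H̃_q = nextH D_q (toHam u) (mulExt v)`.
The LINE form (`z = y`) is the package discharge `exists_weakNormLE_blockB4_line` of the kernel-level four-kernel bound (the tree's
`ℓ = 2` pair property of Lemma 8.4 is along lines); the parallelogram follows from the line form by the predicate version of the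
`C^{1,1}` subdivision step (`SecondDifferencePredicateBilinear.predicate_secondDiff_bilinear`) for the norm-bound predicate
`N(K, c) :↔ (∀ X, K(X) ∈ C^{r₀}) ∧ ‖K‖_{k+1}^{(A)} ≤ c` on polymer activities (monotone, subadditive, symmetric), the entry-sum size
`|·|₁` on tuning matrices and the convex tuning ball:

* `exists_weakNormLE_blockB4` — the parallelogram bound for every package with `0 < P.r` (any dimension);
* **`stub_blockB4`** — the registered stub BY NAME (`d = 4`).

With the landed `stub_f4l2ShrinkLoc_of_blockB4` (p834050) this closes `stub_f4l2ShrinkLoc`, the last open stub of the line.  All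
proved, no `sorry`.  Honest scope: rung route (stiffness of a complex Gaussian gradient field via the [ABKM19] RG); nothing about
superconductivity in the Hubbard model.

## References
* S. Adams, S. Buchholz, R. Kotecký, S. Müller, arXiv:1910.13564, Theorem 6.8, Lemma 8.4 (`ℓ = 2`), Lemma 12.6 (12.53)
  [AdamsBuchholzKoteckyMuller2019].
-/

noncomputable section

-- `Summit.<Summit>.<Problem>`: single-conjunct summit, the duplicate component is mandated (D-0017).
set_option linter.dupNamespace false

namespace Summit.HubbardSuperconductivity.HubbardSuperconductivity.Theorems.ComplexGFF

open scoped BigOperators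
open Finset
open Literature.MathematicalPhysics.StatisticalMechanics.GradientRG
open Literature.MathematicalPhysics.StatisticalMechanics.TorusPolymer
  (IsPolymer blockOf blocks numBlocks thicken reblock card_blocks_eq_numBlocks)
open Literature.Barriers.CriticalPhenomena.LongRangePhi4.Polymer (IsConn)
open Literature.MathematicalPhysics.StatisticalMechanics
open Literature.MathematicalPhysics.QuantumFieldTheory

variable {d : ℕ}

/-- `|c • y|₁ = |c|·|y|₁` (plumbing). -/
private theorem esum_smul' (c : ℝ) (y : Matrix (Fin d) (Fin d) ℝ) : esum (c • y) = |c| * esum y := by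
  unfold esum
  rw [Finset.mul_sum]
  refine Finset.sum_congr rfl fun i _ => ?_
  rw [Finset.mul_sum]
  refine Finset.sum_congr rfl fun j _ => ?_
  rw [Matrix.smul_apply, smul_eq_mul, abs_mul]

/-- `|y + z|₁ ≤ |y|₁ + |z|₁` (plumbing). -/
private theorem esum_add_le' (y z : Matrix (Fin d) (Fin d) ℝ) : esum (y + z) ≤ esum y + esum z := by
  unfold esum
  rw [← Finset.sum_add_distrib]
  refine Finset.sum_le_sum fun i _ => ?_
  rw [← Finset.sum_add_distrib]
  refine Finset.sum_le_sum fun j _ => ?_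
  rw [Matrix.add_apply]
  exact abs_add_le _ _

/-- `|y|₁ = 0 → y = 0` (plumbing). -/
private theorem eq_zero_of_esum_eq_zero' (y : Matrix (Fin d) (Fin d) ℝ) (h : esum y = 0) : y = 0 := by
  unfold esum at h
  ext i j
  have hi := (Finset.sum_eq_zero_iff_of_nonneg (fun i _ => Finset.sum_nonneg fun j _ => abs_nonneg (y i j))).1 h i
    (Finset.mem_univ i)
  have hij := (Finset.sum_eq_zero_iff_of_nonneg (fun j _ => abs_nonneg (y i j))).1 hi j (Finset.mem_univ j)
  simpa using hij

/-- The tuning ball `{q symmetric, |q|₁ ≤ T₀}` is convex (plumbing). -/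
private theorem convex_inBall' (P : PackageData d) : Convex ℝ {ρ : Matrix (Fin d) (Fin d) ℝ | P.InBall ρ} := by
  intro x hx y hy a b ha hb hab
  refine ⟨(hx.1.smul a).add (hy.1.smul b), ?_⟩
  have h1 : ∑ i, ∑ j, |(a • x + b • y) i j| ≤ a * ∑ i, ∑ j, |x i j| + b * ∑ i, ∑ j, |y i j| := by
    have e1 := esum_add_le' (a • x) (b • y)
    rw [esum_smul' a x, esum_smul' b y, abs_of_nonneg ha, abs_of_nonneg hb] at e1
    exact e1
  have h2 : a * ∑ i, ∑ j, |x i j| + b * ∑ i, ∑ j, |y i j| ≤ a * P.T₀ + b * P.T₀ :=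
    add_le_add (mul_le_mul_of_nonneg_left hx.2 ha) (mul_le_mul_of_nonneg_left hy.2 hb)
  calc ∑ i, ∑ j, |(a • x + b • y) i j| ≤ a * P.T₀ + b * P.T₀ := h1.trans h2
    _ = P.T₀ := by rw [← add_mul, hab, one_mul]

set_option maxHeartbeats 1600000 in
/-- **Block B4 (package level): the kernel parallelogram of `K_{k+1}` at the fixed intermediate Hamiltonian, `N`-free** (module
docstring; any dimension). [cite: AdamsBuchholzKoteckyMuller2019, Lemma 12.6 (12.53) / Theorem 6.8 / Lemma 8.4 (ℓ = 2)] -/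
theorem exists_weakNormLE_blockB4 (P : PackageData d) [Fact (0 < P.h)] [Fact (0 < P.L)] (hr0 : 0 < P.r) :
    ∃ l₄ T₂ : ℝ, 0 ≤ l₄ ∧ 0 < T₂ ∧ ∀ (N M : ℕ) [NeZero M] (Q : PackageAt P N M),
      ∀ q y z : Matrix (Fin d) (Fin d) ℝ, P.InBall q → P.InBall (q + y) → P.InBall (q + z) → P.InBall (q + y + z) →
      esum y ≤ T₂ → esum z ≤ T₂ → ∀ k, k + 1 ≤ N →
      ∀ (u : HamSpace ℂ d (fieldWt P.h (P.L : ℝ) d k) ((P.L : ℝ) ^ k) (P.L ^ (d * k)))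
        (v : activitySpace Q.normParams k) (cv : ℝ), ‖u‖ ≤ P.r →
        activityNormLE Q.normParams k v cv → cv ≤ P.r →
      WeakNormLE Q.normParams (k + 1)
        (fun X ψ =>
          nextK (abkmStepData P.L P.R k (Q.kernels (q + y + z))).s
              (reblock (abkmStepData P.L P.R k (Q.kernels (q + y + z))).s
                ((abkmStepData P.L P.R k (Q.kernels (q + y + z))).L * (abkmStepData P.L P.R k (Q.kernels (q + y + z))).s))
              (stepMeasure (abkmStepData P.L P.R k (Q.kernels (q + y + z))).𝒞) (expNegH (HamSpace.toHam u))
              (expNegH (nextH (abkmStepData P.L P.R k (Q.kernels q)) (HamSpace.toHam u)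
                (mulExt ((v : activitySpace Q.normParams k) : Finset (Fin d → ZMod M) → ((Fin d → ZMod M) → ℝ) → ℂ))))
              (mulExt ((v : activitySpace Q.normParams k) : Finset (Fin d → ZMod M) → ((Fin d → ZMod M) → ℝ) → ℂ)) X ψ -
          nextK (abkmStepData P.L P.R k (Q.kernels (q + y))).s
              (reblock (abkmStepData P.L P.R k (Q.kernels (q + y))).s
                ((abkmStepData P.L P.R k (Q.kernels (q + y))).L * (abkmStepData P.L P.R k (Q.kernels (q + y))).s))
              (stepMeasure (abkmStepData P.L P.R k (Q.kernels (q + y))).𝒞) (expNegH (HamSpace.toHam u))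
              (expNegH (nextH (abkmStepData P.L P.R k (Q.kernels q)) (HamSpace.toHam u)
                (mulExt ((v : activitySpace Q.normParams k) : Finset (Fin d → ZMod M) → ((Fin d → ZMod M) → ℝ) → ℂ))))
              (mulExt ((v : activitySpace Q.normParams k) : Finset (Fin d → ZMod M) → ((Fin d → ZMod M) → ℝ) → ℂ)) X ψ -
          nextK (abkmStepData P.L P.R k (Q.kernels (q + z))).s
              (reblock (abkmStepData P.L P.R k (Q.kernels (q + z))).s
                ((abkmStepData P.L P.R k (Q.kernels (q + z))).L * (abkmStepData P.L P.R k (Q.kernels (q + z))).s))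
              (stepMeasure (abkmStepData P.L P.R k (Q.kernels (q + z))).𝒞) (expNegH (HamSpace.toHam u))
              (expNegH (nextH (abkmStepData P.L P.R k (Q.kernels q)) (HamSpace.toHam u)
                (mulExt ((v : activitySpace Q.normParams k) : Finset (Fin d → ZMod M) → ((Fin d → ZMod M) → ℝ) → ℂ))))
              (mulExt ((v : activitySpace Q.normParams k) : Finset (Fin d → ZMod M) → ((Fin d → ZMod M) → ℝ) → ℂ)) X ψ +
          nextK (abkmStepData P.L P.R k (Q.kernels q)).s
              (reblock (abkmStepData P.L P.R k (Q.kernels q)).s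
                ((abkmStepData P.L P.R k (Q.kernels q)).L * (abkmStepData P.L P.R k (Q.kernels q)).s))
              (stepMeasure (abkmStepData P.L P.R k (Q.kernels q)).𝒞) (expNegH (HamSpace.toHam u))
              (expNegH (nextH (abkmStepData P.L P.R k (Q.kernels q)) (HamSpace.toHam u)
                (mulExt ((v : activitySpace Q.normParams k) : Finset (Fin d → ZMod M) → ((Fin d → ZMod M) → ℝ) → ℂ))))
              (mulExt ((v : activitySpace Q.normParams k) : Finset (Fin d → ZMod M) → ((Fin d → ZMod M) → ℝ) → ℂ)) X ψ)
        (l₄ * esum y * esum z * max ‖u‖ cv) := by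
  obtain ⟨l, hl0, hline⟩ := exists_weakNormLE_blockB4_line P hr0
  refine ⟨4 * l, 1, by positivity, one_pos, fun N M _ Q => ?_⟩
  intro q y z hq hqy hqz hqyz hyT hzT k hk u v cv hu hv hcv
  have hPA : 0 < Q.normParams.A := P.A_pos
  have hk1 : 1 ≤ P.L ^ k := Nat.one_le_pow _ _ P.hLodd.pos
  have hMt : M = Q.normParams.L ^ k * P.L ^ (N - k) := by
    show M = P.L ^ k * P.L ^ (N - k)
    rw [Q.hM, ← pow_add, Nat.add_sub_cancel' (by omega)]
  have hcv0 : 0 ≤ cv := nonneg_of_weakNormLE hPA hMt P.hLodd.pow P.hLodd.pow hv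
  set mx := max ‖u‖ cv with hmxdef
  have hmx0 : 0 ≤ mx := le_max_of_le_left (norm_nonneg _)
  -- the state and the fixed intermediate Hamiltonian
  set Kf := mulExt ((v : activitySpace Q.normParams k) :
    Finset (Fin d → ZMod M) → ((Fin d → ZMod M) → ℝ) → ℂ) with hKfdef
  set Ht := nextH (abkmStepData P.L P.R k (Q.kernels q)) (HamSpace.toHam u) Kf with hHtdef
  have hH8 : hamNorm (fieldWt P.h (P.L : ℝ) d k) ((P.L : ℝ) ^ k) (P.L ^ (d * k)) (HamSpace.toHam u) ≤ 1 / 8 := by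
    rw [← HamSpace.norm_def]; exact hu.trans (P.hr.trans (by norm_num))
  have hKr : WeakNormLE Q.normParams k Kf cv := activitySpace.weakNormLE_mulExt v hv
  have hKd : ∀ Y, ContDiff ℝ P.r₀ (Kf Y) := activitySpace.contDiff_mulExt v
  have hKloc : ∀ Y, IsPolymer (P.L ^ k) Y → IsConn Y → IsGaugeLocal (Q.normParams.gauge k Y) (Kf Y) :=
    fun Y hY hYc => activitySpace.isGaugeLocal_mulExt v hY hYc
  -- the map `ρ ↦ G_ρ(H̃_q)`
  set f : Matrix (Fin d) (Fin d) ℝ → (Finset (Fin d → ZMod M) → ((Fin d → ZMod M) → ℝ) → ℂ) := fun ρ X ψ =>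
    nextK (abkmStepData P.L P.R k (Q.kernels ρ)).s
      (reblock (abkmStepData P.L P.R k (Q.kernels ρ)).s
        ((abkmStepData P.L P.R k (Q.kernels ρ)).L * (abkmStepData P.L P.R k (Q.kernels ρ)).s))
      (stepMeasure (abkmStepData P.L P.R k (Q.kernels ρ)).𝒞) (expNegH (HamSpace.toHam u)) (expNegH Ht) Kf X ψ with hf
  have hcd : ∀ {ρ : Matrix (Fin d) (Fin d) ℝ}, P.InBall ρ → ∀ X : Finset (Fin d → ZMod M), ContDiff ℝ P.r₀ (f ρ X) := by
    intro ρ hρ X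
    exact contDiff_nextK_freeHt_abkm_of_stepKernelBounds P.hd P.hLodd P.hL Q.hM hk P.hp P.hpM P.hMR Q.hB P.hδ₀ P.hδ₁
      P.hh P.hh0 P.hA1 (abkmStepData P.L P.R k (Q.kernels ρ)) rfl rfl (packageAt_stepKernelBounds P Q hρ hk) (x₀ := 0) rfl rfl
      hH8 Ht hcv0 hKr (factorises_mulExt hk1) (fun φ => mulExt_empty φ) hKd hKloc X
  -- the line bound as the hypothesis of the predicate subdivision lemma
  have hline' : ∀ x h : Matrix (Fin d) (Fin d) ℝ, x ∈ {ρ : Matrix (Fin d) (Fin d) ℝ | P.InBall ρ} →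
      x + h ∈ {ρ : Matrix (Fin d) (Fin d) ℝ | P.InBall ρ} → x + h + h ∈ {ρ : Matrix (Fin d) (Fin d) ℝ | P.InBall ρ} →
      esum h ≤ (1 : ℝ) →
      (∀ X, ContDiff ℝ P.r₀ ((f (x + h + h) - f (x + h) - f (x + h) + f x) X)) ∧
        WeakNormLE Q.normParams (k + 1) (f (x + h + h) - f (x + h) - f (x + h) + f x) (l * mx * esum h ^ 2) := by
    intro x h hx hxh hxhh _
    refine ⟨fun X => (((hcd hxhh X).sub (hcd hxh X)).sub (hcd hxh X)).add (hcd hx X), ?_⟩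
    have hW := hline N M Q q x h hq hx hxh hxhh k hk u v cv hu hv hcv
    exact hW.mono hPA (le_of_eq (by rw [hmxdef]; ring))
  -- the norm-bound predicate `N(K, c) :↔ (∀ X, K X ∈ C^{r₀}) ∧ ‖K‖_{k+1} ≤ c` is monotone, subadditive, symmetric, `N(0,0)`
  have hzero : ((∀ X, ContDiff ℝ P.r₀ ((0 : (Finset (Fin d → ZMod M) → ((Fin d → ZMod M) → ℝ) → ℂ)) X)) ∧ WeakNormLE Q.normParams (k + 1) (0 : (Finset (Fin d → ZMod M) → ((Fin d → ZMod M) → ℝ) → ℂ)) 0) :=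
    ⟨fun X => contDiff_const, WeakNormLE.zero⟩
  have hmono : ∀ (x : (Finset (Fin d → ZMod M) → ((Fin d → ZMod M) → ℝ) → ℂ)) (c c' : ℝ), ((∀ X, ContDiff ℝ P.r₀ (x X)) ∧ WeakNormLE Q.normParams (k + 1) x c) → c ≤ c' → ((∀ X, ContDiff ℝ P.r₀ (x X)) ∧ WeakNormLE Q.normParams (k + 1) x c') :=
    fun x c c' hx hcc' => ⟨hx.1, hx.2.mono hPA hcc'⟩
  have hadd : ∀ (x x' : (Finset (Fin d → ZMod M) → ((Fin d → ZMod M) → ℝ) → ℂ)) (c c' : ℝ), ((∀ X, ContDiff ℝ P.r₀ (x X)) ∧ WeakNormLE Q.normParams (k + 1) x c) → ((∀ X, ContDiff ℝ P.r₀ (x' X)) ∧ WeakNormLE Q.normParams (k + 1) x' c') →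
      ((∀ X, ContDiff ℝ P.r₀ ((x + x') X)) ∧ WeakNormLE Q.normParams (k + 1) (x + x') (c + c')) :=
    fun x x' c c' hx hx' => ⟨fun X => (hx.1 X).add (hx'.1 X), hx.2.add hx'.2 hx.1 hx'.1⟩
  have hneg : ∀ (x : (Finset (Fin d → ZMod M) → ((Fin d → ZMod M) → ℝ) → ℂ)) (c : ℝ), ((∀ X, ContDiff ℝ P.r₀ (x X)) ∧ WeakNormLE Q.normParams (k + 1) x c) → ((∀ X, ContDiff ℝ P.r₀ ((-x) X)) ∧ WeakNormLE Q.normParams (k + 1) (-x) c) :=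
    fun x c hx => ⟨fun X => (hx.1 X).neg, hx.2.neg hx.1⟩
  have key := predicate_secondDiff_bilinear
    (N := fun (K : (Finset (Fin d → ZMod M) → ((Fin d → ZMod M) → ℝ) → ℂ)) (c : ℝ) => (∀ X, ContDiff ℝ P.r₀ (K X)) ∧ WeakNormLE Q.normParams (k + 1) K c)
    (σ := esum) (s := {ρ : Matrix (Fin d) (Fin d) ℝ | P.InBall ρ}) (f := f) (M := l * mx) (T := 1)
    hzero hmono hadd hneg
    (fun y => entrySum_nonneg y) esum_smul' esum_add_le' eq_zero_of_esum_eq_zero'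
    (convex_inBall' P) (by positivity) hline' hq hqy hqz hqyz hyT hzT
  exact key.2.mono hPA (le_of_eq (by ring))

/-- **Registered stub `stub_blockB4` of the skeleton `banach_two_kernel` (crux child `TwoKernelSkBound`, stmt-…-27414), BY NAME:
block B4 — the kernel parallelogram at the fixed intermediate Hamiltonian — for every `d = 4` package with positive radius.**
[cite: AdamsBuchholzKoteckyMuller2019, Lemma 12.6 (12.53) / Theorem 6.8 / Lemma 8.4 (ℓ = 2)] -/
theorem stub_blockB4 :
    ∀ (P : PackageData 4) [Fact (0 < P.h)] [Fact (0 < P.L)], 0 < P.r →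
      ∃ l₄ T₂ : ℝ, 0 ≤ l₄ ∧ 0 < T₂ ∧ ∀ (N M : ℕ) [NeZero M] (Q : PackageAt P N M),
      ∀ q y z : Matrix (Fin 4) (Fin 4) ℝ, P.InBall q → P.InBall (q + y) → P.InBall (q + z) → P.InBall (q + y + z) →
      esum y ≤ T₂ → esum z ≤ T₂ → ∀ k, k + 1 ≤ N →
      ∀ (u : HamSpace ℂ 4 (fieldWt P.h (P.L : ℝ) 4 k) ((P.L : ℝ) ^ k) (P.L ^ (4 * k)))
        (v : activitySpace Q.normParams k) (cv : ℝ), ‖u‖ ≤ P.r →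
        activityNormLE Q.normParams k v cv → cv ≤ P.r →
      WeakNormLE Q.normParams (k + 1)
        (fun X ψ =>
          nextK (abkmStepData P.L P.R k (Q.kernels (q + y + z))).s
              (reblock (abkmStepData P.L P.R k (Q.kernels (q + y + z))).s
                ((abkmStepData P.L P.R k (Q.kernels (q + y + z))).L * (abkmStepData P.L P.R k (Q.kernels (q + y + z))).s))
              (stepMeasure (abkmStepData P.L P.R k (Q.kernels (q + y + z))).𝒞) (expNegH (HamSpace.toHam u))
              (expNegH (nextH (abkmStepData P.L P.R k (Q.kernels q)) (HamSpace.toHam u)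
                (mulExt ((v : activitySpace Q.normParams k) : Finset (Fin 4 → ZMod M) → ((Fin 4 → ZMod M) → ℝ) → ℂ))))
              (mulExt ((v : activitySpace Q.normParams k) : Finset (Fin 4 → ZMod M) → ((Fin 4 → ZMod M) → ℝ) → ℂ)) X ψ -
          nextK (abkmStepData P.L P.R k (Q.kernels (q + y))).s
              (reblock (abkmStepData P.L P.R k (Q.kernels (q + y))).s
                ((abkmStepData P.L P.R k (Q.kernels (q + y))).L * (abkmStepData P.L P.R k (Q.kernels (q + y))).s))
              (stepMeasure (abkmStepData P.L P.R k (Q.kernels (q + y))).𝒞) (expNegH (HamSpace.toHam u))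
              (expNegH (nextH (abkmStepData P.L P.R k (Q.kernels q)) (HamSpace.toHam u)
                (mulExt ((v : activitySpace Q.normParams k) : Finset (Fin 4 → ZMod M) → ((Fin 4 → ZMod M) → ℝ) → ℂ))))
              (mulExt ((v : activitySpace Q.normParams k) : Finset (Fin 4 → ZMod M) → ((Fin 4 → ZMod M) → ℝ) → ℂ)) X ψ -
          nextK (abkmStepData P.L P.R k (Q.kernels (q + z))).s
              (reblock (abkmStepData P.L P.R k (Q.kernels (q + z))).s
                ((abkmStepData P.L P.R k (Q.kernels (q + z))).L * (abkmStepData P.L P.R k (Q.kernels (q + z))).s))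
              (stepMeasure (abkmStepData P.L P.R k (Q.kernels (q + z))).𝒞) (expNegH (HamSpace.toHam u))
              (expNegH (nextH (abkmStepData P.L P.R k (Q.kernels q)) (HamSpace.toHam u)
                (mulExt ((v : activitySpace Q.normParams k) : Finset (Fin 4 → ZMod M) → ((Fin 4 → ZMod M) → ℝ) → ℂ))))
              (mulExt ((v : activitySpace Q.normParams k) : Finset (Fin 4 → ZMod M) → ((Fin 4 → ZMod M) → ℝ) → ℂ)) X ψ +
          nextK (abkmStepData P.L P.R k (Q.kernels q)).s
              (reblock (abkmStepData P.L P.R k (Q.kernels q)).s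
                ((abkmStepData P.L P.R k (Q.kernels q)).L * (abkmStepData P.L P.R k (Q.kernels q)).s))
              (stepMeasure (abkmStepData P.L P.R k (Q.kernels q)).𝒞) (expNegH (HamSpace.toHam u))
              (expNegH (nextH (abkmStepData P.L P.R k (Q.kernels q)) (HamSpace.toHam u)
                (mulExt ((v : activitySpace Q.normParams k) : Finset (Fin 4 → ZMod M) → ((Fin 4 → ZMod M) → ℝ) → ℂ))))
              (mulExt ((v : activitySpace Q.normParams k) : Finset (Fin 4 → ZMod M) → ((Fin 4 → ZMod M) → ℝ) → ℂ)) X ψ)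
        (l₄ * esum y * esum z * max ‖u‖ cv) :=
  fun P _ _ hr => exists_weakNormLE_blockB4 P hr

end Summit.HubbardSuperconductivity.HubbardSuperconductivity.Theorems.ComplexGFF

end
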